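import Summits.QuantumFields.YangMills.Theorems.BalabanUVNodesN21LowCentreEndAtSUNBlockChartJacobianEnd

/-!
# N21 (NE7c) · THE [LF-II] §1-LETTERS END ON THE EXPONENTIAL `SU(N)` BLOCK CHART, V: A6 WITNESS of ★ `cutChartLawAC_of_sect1Letters_dressed`
# — EVERY binder discharged in the kernel at `N = 2`, ONE bond, window `S = ½`, the Haar Jacobian's letter `W_J = −8·log sinc ½ ≤ 8∕23` INCLUDED

Width seat pub-ymgap-dag-n21-w1 (g2; director-ym №197 ∕ HUMAN RULING D-0149), node N21 = NE7c (single-run shell-weight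
bound, NOT PRINTED in [Bałaban 1983–89], NOT proved), lane K3⁷ `SpineGivenEndpointR13SepCoPH` (stmt-QuantumFields-20544,
`--kind proof --supports … --as helper`).  Thirteenth file of the seat's item-1 chain; companion of `…JacobianEnd` (★
`cutChartLawAC_of_sect1Letters_dressed`: the cut chart law's (M1) with the Haar Jacobian in the exponent).  Director-ym STANDING A6
RULE №189 (3): a junction theorem with a long analytic binder list gets a satisfiability witness.  THEOREMS ONLY: 0 `def`, 0 `sorry`.

WHAT IS PROVED ([textbook]).
* `neg_log_sinc_half_le` — `sinc ½ ≥ 23∕24` (Mathlib `Real.sin_gt_sub_cube`) hence `−log sinc ½ ≤ 1∕23`: the Jacobian letter of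
  `…Jacobian` at `N = 2`, one bond, `S = ½` is `W_J = 1·(2·2)·(−2 log sinc ½) ≤ 8∕23`.
* ★ `cutChartLaw_dressed_binders_inhabited` — ONE CONCRETE BLOCK (lattice `Params.mk 1 3 0 0 …`, scale `0`, the bond `⟨default, 0⟩`),
  `N = 2` (`d_2 = 3`), window `S = ½`, kept cuts `K₀ = univ`, dressed exponent `A(z) = ½Σ‖z b′‖²` (expansion `Q = Σ‖·‖²`,
  `lin = Vt = 0`), rows at `γ₀ = 1, d = 1, M = 1∕100, B₃ = 1∕144, M₀ = A₀ = p₀(g) = 1, R_k = 0` (`W = 1∕48`, `W_V = 0`), statistic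
  `‖z‖` (`L = 1`, `σ = 0`, `κ₀ = 1`), `C = univ`, `Env = {‖z‖ < θ}`, `Q = 0`, letter `θ = 10`, `ρ = ½`: EVERY binder of ★ holds and
  the clause reads `16·(1∕48 + W_J)·1·1·3 = 1 + 384·(−log sinc ½) ≤ 1 + 384∕23 < 25 = (10·½)²`.  A satisfiability witness of the
  binder list, not an estimate on Bałaban's measure.

HONEST FRAMING.  [textbook] real analysis (one sine bound) + composition BY NAME; nothing of Bałaban's asserted; NE7c NOT PRINTED ∕
NOT proved; N21 NOT discharged; K3⁷ NOT claimed; counts unmoved (typed 28∕28 · discharged 5∕27); never a count claim; one finite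
𝕋⁴ at fixed ε — R4 would close only the conditional finite-𝕋⁴ rung `BalabanLadder.UV`, NOT the Yang–Mills mass gap (Clay);
nothing about ℝ⁴ ∕ OS.

v1.1 (APPEND-ONLY; v1 declarations byte-identical): ★′ `cutChartLaw_dressed_binders_inhabited_sharp` — the same witness at
`(θ, ρ) = (500, 1∕100)`, where `D·ρ < 1` makes the concluded (M1) non-trivial as a statement (ref-F READ-488 ADVISORY-1).
-/

set_option autoImplicit false

noncomputable section

open MeasureTheory Set Function Finset Metric
open scoped ENNReal BigOperators

namespace Summit.QuantumFields.YangMills.Theorems.N21LowCentreEndAtSUNBlockChartJacobianWitness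

open Literature.MathematicalPhysics.QuantumFieldTheory.Balaban1983to89
open Literature.MathematicalPhysics.QuantumFieldTheory.Balaban1983to89.T4Continuum
open Literature.MathematicalPhysics.QuantumFieldTheory.Balaban1983to89.Node00 hiding dimSU
open Literature.MathematicalPhysics.QuantumFieldTheory.Balaban1983to89.T4ShellMeasure (SlotAntiConcentration)
open Literature.MathematicalPhysics.QuantumFieldTheory.Balaban1983to89.B16Sect1Wilson (Ineq16 Ineq19)
open Summit.QuantumFields.BalabanUV.T4Continuum
open Summit.QuantumFields.BalabanUV.T4Continuum.ShellMeasureExpChartSUN (ChartSU BlockChartSU dimSU dimSU_eq chartWeightSU)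
open Summit.QuantumFields.BalabanUV.T4Continuum.ShellMeasureExpJacobianSUN (expJacWeightSU)
open Summit.QuantumFields.BalabanUV.T4Continuum.ShellMeasureExpHaarAreaSUN (kappaSU)
open Summit.QuantumFields.BalabanUV.T4Continuum.ShellMeasureExpDuhamelSUN (duhT)
open Summit.QuantumFields.YangMills.Theorems.N21LowCentreEndAtSUNBlockChartRecord (convexOn_halfSumNormSq)
open Summit.QuantumFields.YangMills.Theorems.N21LowCentreEndAtSUNBlockChartJacobianEnd (cutChartLawAC_of_sect1Letters_dressed)

/-- **THE JACOBIAN LETTER IN NUMBERS AT `S = ½`**: `sinc ½ = 2 sin ½ ≥ 2·(½ − 1∕48) = 23∕24` (`Real.sin_gt_sub_cube`), hence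
`−log sinc ½ = log (sinc ½)⁻¹ ≤ (sinc ½)⁻¹ − 1 ≤ 24∕23 − 1 = 1∕23`. [textbook] -/
theorem neg_log_sinc_half_le : -Real.log (Real.sinc (1 / 2)) ≤ 1 / 23 := by
  have hsin : (1 : ℝ) / 2 - (1 / 2) ^ 3 / 6 < Real.sin (1 / 2) := Real.sin_gt_sub_cube (by norm_num)
  have hsinc : (23 : ℝ) / 24 ≤ Real.sinc (1 / 2) := by
    rw [Real.sinc_of_ne_zero (by norm_num : (1 : ℝ) / 2 ≠ 0)]
    rw [le_div_iff₀ (by norm_num : (0 : ℝ) < 1 / 2)]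
    nlinarith
  have hs0 : 0 < Real.sinc (1 / 2) := by linarith
  rw [← Real.log_inv]
  have hinv : (Real.sinc (1 / 2))⁻¹ ≤ 24 / 23 := by
    rw [inv_le_comm₀ hs0 (by norm_num)]
    norm_num
    exact hsinc
  linarith [Real.log_le_sub_one_of_pos (inv_pos.mpr hs0)]

/-- ★ **A6 WITNESS OF ★ `cutChartLawAC_of_sect1Letters_dressed`** (director-ym STANDING A6 RULE №189 (3)): at the concrete one-bond
block, `N = 2`, `S = ½`, EVERY binder — dressed presentation data, printed rows as real inequalities, statistic, envelope, radial
transversality, odds, and the ONE clause WITH THE HAAR JACOBIAN's `W_J` — discharged in the kernel (`dimSU_eq`: `d_2 = 3`;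
`neg_log_sinc_half_le`).  A satisfiability witness of the binder list, not an estimate on Bałaban's measure. [textbook] -/
theorem cutChartLaw_dressed_binders_inhabited :
    ∃ (P : Params) (j : ℕ) (b : Finset (PBond P j)), b.card = 1 ∧
      SlotAntiConcentration
        (((volume : Measure (BlockChartSU 2 b)).withDensity fun z =>
            ((univ : Set (BlockChartSU 2 b)) ∩ closedBall (0 : BlockChartSU 2 b) (1 / 2)).indicator
              (fun w => ENNReal.ofReal (Real.exp (-((∑ i, ‖w i‖ ^ 2) / 2 +
                (∑ i, -Real.log (LinearMap.det (duhT (w i) : ChartSU 2 →ₗ[ℝ] ChartSU 2))) -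
                  b.card * Real.log (kappaSU 2).toReal)))) z).restrict
          ({z : BlockChartSU 2 b | ‖z‖ < 10} ∩ univ))
        (fun z : BlockChartSU 2 b => ‖z‖) 10 (1 / 2) (3 * ((b.card : ℝ) * dimSU 2 + 1) * (1 + 0) / (1 * (1 - 1 / 2))) := by
  refine ⟨Params.mk 1 3 0 0 le_rfl ⟨⟨1, rfl⟩, Nat.one_lt_two.trans (Nat.lt_succ_self 2)⟩, 0, {⟨default, 0⟩},
    Finset.card_singleton _, ?_⟩
  set b : Finset (PBond (Params.mk 1 3 0 0 le_rfl ⟨⟨1, rfl⟩, Nat.one_lt_two.trans (Nat.lt_succ_self 2)⟩) 0) :=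
    {⟨default, 0⟩} with hb_def
  have hb : b.Nonempty := Finset.singleton_nonempty _
  have hb1 : b.card = 1 := Finset.card_singleton _
  have hd2 : (dimSU 2 : ℝ) = 3 := by rw [dimSU_eq]; norm_num
  -- measurability of the dressed presentation and of the statistic
  have hφc : Continuous fun w : BlockChartSU 2 b => (∑ i, ‖w i‖ ^ 2) / 2 :=
    (continuous_finsetSum _ fun i _ => ((continuous_apply i).norm).pow 2).div_const 2
  have hAm : Measurable fun z : BlockChartSU 2 b => (univ : Set (BlockChartSU 2 b)).indicator
      (fun w => ENNReal.ofReal (Real.exp (-((∑ i, ‖w i‖ ^ 2) / 2)))) z := by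
    simp only [indicator_univ]
    exact ENNReal.measurable_ofReal.comp (Real.measurable_exp.comp hφc.measurable.neg)
  have hUm : Measurable fun z : BlockChartSU 2 b => ‖z‖ := measurable_norm
  have hEnv : MeasurableSet {z : BlockChartSU 2 b | ‖z‖ < 10} := measurableSet_lt hUm measurable_const
  have hJ := neg_log_sinc_half_le
  refine cutChartLawAC_of_sect1Letters_dressed (N := 2) le_rfl b hb (S := 1 / 2) (by norm_num)
    (by linarith [Real.pi_gt_three]) univ (fun w => (∑ i, ‖w i‖ ^ 2) / 2) (fun w => ∑ i, ‖w i‖ ^ 2) (fun _ => 0) (fun _ => 0)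
    hAm hUm MeasurableSet.univ hEnv (Env := {z : BlockChartSU 2 b | ‖z‖ < 10}) (σ := 0) (κ₀ := 1) (Q := 0) (L := 1)
    (γ₀ := 1) (M := 1 / 100) (B₃ := 1 / 144) (M₀ := 1) (A₀ := 1) (p₀g := 1) (Rk := 0) (WV := 0) (d := 1)
    (by norm_num) (by norm_num) (by norm_num) (by norm_num) one_pos le_rfl one_pos le_rfl (by norm_num) one_pos ?_
    convex_univ (convexOn_halfSumNormSq b) (mem_univ _) ?_ ?_ ?_ ?_ ?_ ?_ ?_ ?_ ?_ ?_
  · -- hW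
    simp
  · -- hexp: `A v = A 0 + ½·Q v + 0 + 0`
    intro v _
    show (∑ i, ‖v i‖ ^ 2) / 2 = (∑ i, ‖(0 : BlockChartSU 2 b) i‖ ^ 2) / 2 + 1 / 2 * (∑ i, ‖v i‖ ^ 2) + 0 + 0
    have h0 : (∑ i, ‖(0 : BlockChartSU 2 b) i‖ ^ 2) = 0 := by simp
    rw [h0]
    ring
  · -- h19 (1.9) as a real inequality: `½·Σ ≤ Σ`
    intro v _
    have hS : 0 ≤ ∑ i, ‖v i‖ ^ 2 := Finset.sum_nonneg fun i _ => sq_nonneg _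
    show (1 : ℝ) / (2 * ((1 : ℕ) : ℝ) * (100 * (1 / 100)) ^ (1 + 1)) * (∑ i, ‖v i‖ ^ 2) ≤ ∑ i, ‖v i‖ ^ 2
    calc (1 : ℝ) / (2 * ((1 : ℕ) : ℝ) * (100 * (1 / 100)) ^ (1 + 1)) * (∑ i, ‖v i‖ ^ 2)
        = 1 / 2 * (∑ i, ‖v i‖ ^ 2) := by norm_num
      _ ≤ ∑ i, ‖v i‖ ^ 2 := by linarith
  · -- h16 (1.6): `|0| < 3·(1/144)·…`
    intro v _
    unfold Ineq16
    norm_num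
  · -- hV
    intro v _
    simp
  · -- hUL: the norm is 1-Lipschitz
    intro a a'
    rw [one_mul]
    exact (le_abs_self _).trans (abs_norm_sub_norm_le a a')
  · -- hUc
    simp
  · -- the clause, with `W_J = 1·(2·2)·(−2 log sinc ½) ≤ 8/23`: `3·16·(1/48 + W_J) ≤ 1 + 384/23 < 25`
    rw [hb1, hd2]
    norm_num
    nlinarith [hJ]
  · -- henv: `‖l • z‖ = l‖z‖ < 10` for `l ∈ [l₀, 1]`
    intro l hl z _ h2 _
    rw [hb1] at hl
    have hl0 : 0 ≤ l := by
      have hx : (0 : ℝ) ≤ (1 : ℕ) * (dimSU 2 : ℝ) := by positivity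
      have : 1 / (((1 : ℕ) : ℝ) * dimSU 2 + 1) ≤ 1 := by
        rw [div_le_one (by positivity)]
        linarith
      linarith [hl.1]
    show ‖l • z‖ < 10
    rw [norm_smul, Real.norm_of_nonneg hl0]
    calc l * ‖z‖ ≤ 1 * ‖z‖ := mul_le_mul_of_nonneg_right hl.2 (norm_nonneg _)
      _ = ‖z‖ := one_mul _
      _ < 10 := h2
  · -- hRT: `‖s • z‖ = s‖z‖`
    intro z h1 _ _ s hs _ _ _
    rw [norm_smul, Real.norm_of_nonneg (by linarith : (0 : ℝ) ≤ s)]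
    nlinarith [mul_le_mul_of_nonneg_left h1 (show (0 : ℝ) ≤ s - 1 by linarith)]
  · -- hQ: the envelope IS the sub-level event (Q = 0)
    have hempty : {z : BlockChartSU 2 b | ‖z‖ < 10} \ ({z : BlockChartSU 2 b | ‖z‖ < 10} ∩ univ) = ∅ := by
      ext z
      simp
    rw [hempty, measure_empty]
    exact zero_le

/-- ★′ (v1.1) **THE SAME WITNESS AT `(θ, ρ) = (500, 1∕100)`** — so that `D·ρ = 12∕0.99·(1∕100) < 1` and the concluded (M1) is NOT
measure-trivial as a STATEMENT (ref-F READ-488 ADVISORY-1); every other datum unchanged. (director-ym STANDING A6 RULE №189 (3)): at the concrete one-bond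
block, `N = 2`, `S = ½`, EVERY binder — dressed presentation data, printed rows as real inequalities, statistic, envelope, radial
transversality, odds, and the ONE clause WITH THE HAAR JACOBIAN's `W_J` — discharged in the kernel (`dimSU_eq`: `d_2 = 3`;
`neg_log_sinc_half_le`).  A satisfiability witness of the binder list, not an estimate on Bałaban's measure. [textbook] -/
theorem cutChartLaw_dressed_binders_inhabited_sharp :
    ∃ (P : Params) (j : ℕ) (b : Finset (PBond P j)), b.card = 1 ∧
      SlotAntiConcentration
        (((volume : Measure (BlockChartSU 2 b)).withDensity fun z =>
            ((univ : Set (BlockChartSU 2 b)) ∩ closedBall (0 : BlockChartSU 2 b) (1 / 2)).indicator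
              (fun w => ENNReal.ofReal (Real.exp (-((∑ i, ‖w i‖ ^ 2) / 2 +
                (∑ i, -Real.log (LinearMap.det (duhT (w i) : ChartSU 2 →ₗ[ℝ] ChartSU 2))) -
                  b.card * Real.log (kappaSU 2).toReal)))) z).restrict
          ({z : BlockChartSU 2 b | ‖z‖ < 500} ∩ univ))
        (fun z : BlockChartSU 2 b => ‖z‖) 500 (1 / 100) (3 * ((b.card : ℝ) * dimSU 2 + 1) * (1 + 0) / (1 * (1 - 1 / 100))) := by
  refine ⟨Params.mk 1 3 0 0 le_rfl ⟨⟨1, rfl⟩, Nat.one_lt_two.trans (Nat.lt_succ_self 2)⟩, 0, {⟨default, 0⟩},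
    Finset.card_singleton _, ?_⟩
  set b : Finset (PBond (Params.mk 1 3 0 0 le_rfl ⟨⟨1, rfl⟩, Nat.one_lt_two.trans (Nat.lt_succ_self 2)⟩) 0) :=
    {⟨default, 0⟩} with hb_def
  have hb : b.Nonempty := Finset.singleton_nonempty _
  have hb1 : b.card = 1 := Finset.card_singleton _
  have hd2 : (dimSU 2 : ℝ) = 3 := by rw [dimSU_eq]; norm_num
  -- measurability of the dressed presentation and of the statistic
  have hφc : Continuous fun w : BlockChartSU 2 b => (∑ i, ‖w i‖ ^ 2) / 2 :=
    (continuous_finsetSum _ fun i _ => ((continuous_apply i).norm).pow 2).div_const 2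
  have hAm : Measurable fun z : BlockChartSU 2 b => (univ : Set (BlockChartSU 2 b)).indicator
      (fun w => ENNReal.ofReal (Real.exp (-((∑ i, ‖w i‖ ^ 2) / 2)))) z := by
    simp only [indicator_univ]
    exact ENNReal.measurable_ofReal.comp (Real.measurable_exp.comp hφc.measurable.neg)
  have hUm : Measurable fun z : BlockChartSU 2 b => ‖z‖ := measurable_norm
  have hEnv : MeasurableSet {z : BlockChartSU 2 b | ‖z‖ < 500} := measurableSet_lt hUm measurable_const
  have hJ := neg_log_sinc_half_le
  refine cutChartLawAC_of_sect1Letters_dressed (N := 2) le_rfl b hb (S := 1 / 2) (by norm_num)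
    (by linarith [Real.pi_gt_three]) univ (fun w => (∑ i, ‖w i‖ ^ 2) / 2) (fun w => ∑ i, ‖w i‖ ^ 2) (fun _ => 0) (fun _ => 0)
    hAm hUm MeasurableSet.univ hEnv (Env := {z : BlockChartSU 2 b | ‖z‖ < 500}) (σ := 0) (κ₀ := 1) (Q := 0) (L := 1)
    (γ₀ := 1) (M := 1 / 100) (B₃ := 1 / 144) (M₀ := 1) (A₀ := 1) (p₀g := 1) (Rk := 0) (WV := 0) (d := 1)
    (by norm_num) (by norm_num) (by norm_num) (by norm_num) one_pos le_rfl one_pos le_rfl (by norm_num) one_pos ?_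
    convex_univ (convexOn_halfSumNormSq b) (mem_univ _) ?_ ?_ ?_ ?_ ?_ ?_ ?_ ?_ ?_ ?_
  · -- hW
    simp
  · -- hexp: `A v = A 0 + ½·Q v + 0 + 0`
    intro v _
    show (∑ i, ‖v i‖ ^ 2) / 2 = (∑ i, ‖(0 : BlockChartSU 2 b) i‖ ^ 2) / 2 + 1 / 2 * (∑ i, ‖v i‖ ^ 2) + 0 + 0
    have h0 : (∑ i, ‖(0 : BlockChartSU 2 b) i‖ ^ 2) = 0 := by simp
    rw [h0]
    ring
  · -- h19 (1.9) as a real inequality: `½·Σ ≤ Σ`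
    intro v _
    have hS : 0 ≤ ∑ i, ‖v i‖ ^ 2 := Finset.sum_nonneg fun i _ => sq_nonneg _
    show (1 : ℝ) / (2 * ((1 : ℕ) : ℝ) * (100 * (1 / 100)) ^ (1 + 1)) * (∑ i, ‖v i‖ ^ 2) ≤ ∑ i, ‖v i‖ ^ 2
    calc (1 : ℝ) / (2 * ((1 : ℕ) : ℝ) * (100 * (1 / 100)) ^ (1 + 1)) * (∑ i, ‖v i‖ ^ 2)
        = 1 / 2 * (∑ i, ‖v i‖ ^ 2) := by norm_num
      _ ≤ ∑ i, ‖v i‖ ^ 2 := by linarith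
  · -- h16 (1.6): `|0| < 3·(1/144)·…`
    intro v _
    unfold Ineq16
    norm_num
  · -- hV
    intro v _
    simp
  · -- hUL: the norm is 1-Lipschitz
    intro a a'
    rw [one_mul]
    exact (le_abs_self _).trans (abs_norm_sub_norm_le a a')
  · -- hUc
    simp
  · -- the clause, with `W_J = 1·(2·2)·(−2 log sinc ½) ≤ 8/23`: `3·16·(1/48 + W_J) ≤ 1 + 384/23 < 25`
    rw [hb1, hd2]
    norm_num
    nlinarith [hJ]
  · -- henv: `‖l • z‖ = l‖z‖ < 500` for `l ∈ [l₀, 1]`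
    intro l hl z _ h2 _
    rw [hb1] at hl
    have hl0 : 0 ≤ l := by
      have hx : (0 : ℝ) ≤ (1 : ℕ) * (dimSU 2 : ℝ) := by positivity
      have : 1 / (((1 : ℕ) : ℝ) * dimSU 2 + 1) ≤ 1 := by
        rw [div_le_one (by positivity)]
        linarith
      linarith [hl.1]
    show ‖l • z‖ < 500
    rw [norm_smul, Real.norm_of_nonneg hl0]
    calc l * ‖z‖ ≤ 1 * ‖z‖ := mul_le_mul_of_nonneg_right hl.2 (norm_nonneg _)
      _ = ‖z‖ := one_mul _
      _ < 500 := h2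
  · -- hRT: `‖s • z‖ = s‖z‖`
    intro z h1 _ _ s hs _ _ _
    rw [norm_smul, Real.norm_of_nonneg (by linarith : (0 : ℝ) ≤ s)]
    nlinarith [mul_le_mul_of_nonneg_left h1 (show (0 : ℝ) ≤ s - 1 by linarith)]
  · -- hQ: the envelope IS the sub-level event (Q = 0)
    have hempty : {z : BlockChartSU 2 b | ‖z‖ < 500} \ ({z : BlockChartSU 2 b | ‖z‖ < 500} ∩ univ) = ∅ := by
      ext z
      simp
    rw [hempty, measure_empty]
    exact zero_le


end Summit.QuantumFields.YangMills.Theorems.N21LowCentreEndAtSUNBlockChartJacobianWitness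

end
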